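import Summits.AtomisticToContinuum.FouriersLaw.Theorems.VanishingNoiseTransferVanishingNoiseBoundFixedLengthNoiseContinuityReductions
import Summits.AtomisticToContinuum.FouriersLaw.Theorems.VanishingNoiseTransferVanishingNoiseBoundFlipResolventUniform
import Summits.AtomisticToContinuum.FouriersLaw.Theorems.VanishingNoiseTransferVanishingNoiseBoundFlipSteadyStateBind

/-!
# Continuity of the flip steady state and of its current in the flip rate at `ε = 0⁺`; the stub
`stub_fixedLengthNoiseContinuity` from equi-differentiability alone

`--supports stmt-AtomisticToContinuum-11976` helper file (crux `VanishingNoiseBound`, route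
`VanishingNoiseTransfer`, line `fekete-usc-one-length`, stub S2 `stub_fixedLengthNoiseContinuity`).
Third and last file on input (P) of `FixedLengthNoiseContinuity.of_equidifferentiable_of_pointwise`
(`...FixedLengthNoiseContinuityReductions.lean`). Proved here, sorry-free, no definitions:

* `exists_flipSteadyState_near` — **the flip steady state is `O(ε)`-close to the steady state**
  (fixed `N ≥ 2`, fixed `T_L, T_R > 0`): there are the steady state `μ⋆` of the transition
  semigroup of `pinnedChain ω₂ lam β γ` and `M ≥ 0` such that for every flip rate `ε` with
  `0 < Nε ≤ 1` some weak flip steady state `μ` of `L + εS` has `|∫ g dμ - ∫ g dμ⋆| ≤ M ε` for all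
  continuous `|g| ≤ e^{θH}`, `θ = 1/(2 max(T_L,T_R))`. Mechanism: `μ = π R_{Nε}` (chain embedded at
  the flip times, `...FlipSteadyStateBind.lean`) with `∫ e^{θH} dπ ≤ b/(1-a)` for rate-UNIFORM
  Lyapunov constants, and `|R_{Nε} g(z) - μ⋆(g)| ≤ M₁ Nε e^{θH(z)}` (CEHR 2018 (2.5) averaged over
  the exponential time, `...FlipResolventUniform.lean`), integrated against `π`. This is the first
  step of Hairer–Majda's linear-response scheme ("`a ↦ μ_a` is Lipschitz at `a₀` in the dual
  weighted norm") for the bounded jump perturbation `εS` of the hypoelliptic Langevin generator.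
* `flipSteadyState_totalCurrent_near` — hence, under weak uniqueness of the steady state and of
  the flip steady state at `(N, T_L, T_R)` (the stub's hypotheses), the steady current of THE flip
  steady state tends to that of THE steady state as `ε → 0⁺` (all `N`; bond currents are
  `O(e^{θH})`); registered helper `helper_flipSteadyStateTotalCurrentNear`.
* `flip_pointwise_continuity` — input (P) verbatim, for the unique deterministic family and every
  `0 < |δ| < 2T`.
* `of_equidifferentiable` — **the stub from (E) alone**: `stub_fixedLengthNoiseContinuity` (fixed
  parameters, `T`, `N`, family `μ0`, response `D0`) follows from the single remaining analytic
  input (E), an `ε`-uniform modulus `ω(δ) → 0` for the response quotients `J(με,δ)/δ - Dε` of the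
  unique flip-steady families (equi-differentiability at `δ = 0`, uniformly in small `ε`): the
  fixed-`N` Hairer–Majda-type first-order regularity of the flip-noisy steady state in the bath
  temperatures, not in the tree and not in print for the jump-perturbed Langevin chain.
-/

noncomputable section

namespace Summit.AtomisticToContinuum.FouriersLaw.Theorems.FixedLengthNoiseContinuity

open MeasureTheory ProbabilityTheory Filter Topology
open scoped NNReal ENNReal ContDiff BoundedContinuousFunction
open Literature.MathematicalPhysics.KineticTheory.HeatConduction

/-! ## §1 Integrals over `π R` -/

section Bind

variable {N : ℕ}

/-- `∫ g d(π R) = ∫ (∫ g dR(z,·)) π(dz)` for every `π R`-integrable `g` (Mathlib's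
`Kernel.integral_comp` through `Measure.comp_eq_comp_const_apply`). -/
theorem integral_bind_of_integrable (R : Kernel (PhaseSpace N) (PhaseSpace N)) [IsMarkovKernel R]
    (π : Measure (PhaseSpace N)) [IsProbabilityMeasure π] {g : PhaseSpace N → ℝ}
    (hg : Integrable g (π.bind R)) : ∫ y, g y ∂(π.bind R) = ∫ z, ∫ y, g y ∂(R z) ∂π := by
  have hint : Integrable g (R ∘ₘ π) := hg
  change ∫ y, g y ∂(R ∘ₘ π) = _
  rw [Measure.comp_eq_comp_const_apply] at hint ⊢
  rw [Kernel.integral_comp hint, Kernel.const_apply]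

end Bind

/-! ## §2 The flip steady state at small rate is close to the steady state -/

section Pinned

variable {ω₂ lam β γ : ℝ} {N : ℕ} {T_L T_R : ℝ}

/-- **A weak flip steady state within `O(ε)` of the steady state, at fixed temperatures.** For
`pinnedChain ω₂ lam β γ` (all parameters `> 0`), `N ≥ 2` and `T_L, T_R > 0` there are the steady
state `μ⋆` of the transition semigroup (a weak `IsSteadyState`) and `M ≥ 0` such that for every
flip rate `ε > 0` with `Nε ≤ 1` there is a weak flip steady state `μ` of `L + εS`
(`OscillatorChain.IsFlipSteadyState`) with `|∫ g dμ - ∫ g dμ⋆| ≤ M ε` for every continuous `g`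
with `|g| ≤ e^{θH}`, `θ = 1/(2 max(T_L,T_R))`. Proof: `μ = π R_{Nε}`
(`exists_isFlipSteadyState_bind_of_resolventKernel`) with `∫ e^{θH} dπ ≤ b/(1-a)` uniformly in
`ε` (`exists_resolventKernel_uniform` (iii)), and `|R_{Nε} g(z) - μ⋆(g)| ≤ M₁ Nε e^{θH(z)}`
(clause (iv)), integrated against `π`. This is the first step ("`a ↦ μ_a` is Lipschitz at `a₀` in
the dual weighted norm") of Hairer–Majda's linear-response framework, for the jump perturbation
`εS` of the hypoelliptic Langevin generator. -/
theorem exists_flipSteadyState_near (hω : 0 < ω₂) (hl : 0 < lam) (hβ : 0 < β) (hγ : 0 < γ)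
    (hN : 1 < N) (hTL : 0 < T_L) (hTR : 0 < T_R) :
    ∃ μs : Measure (PhaseSpace N), IsProbabilityMeasure μs ∧
      (pinnedChain ω₂ lam β γ).IsSteadyState N T_L T_R μs ∧
      ∃ M : ℝ, 0 ≤ M ∧ ∀ ε : ℝ, 0 < ε → (N : ℝ) * ε ≤ 1 →
        ∃ μ : Measure (PhaseSpace N), (pinnedChain ω₂ lam β γ).IsFlipSteadyState N T_L T_R ε μ ∧
          ∀ g : PhaseSpace N → ℝ, Continuous g →
            (∀ y, |g y| ≤ Real.exp (1 / max T_L T_R / 2 *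
              (pinnedChain ω₂ lam β γ).hamiltonian N y)) →
            |∫ y, g y ∂μ - ∫ y, g y ∂μs| ≤ M * ε := by
  have hN0 : 0 < N := by omega
  set P := pinnedChain ω₂ lam β γ
  set θ : ℝ := 1 / max T_L T_R / 2 with hθdef
  have hmax : 0 < max T_L T_R := lt_max_of_lt_left hTL
  have hθ : 0 < θ := by positivity
  obtain ⟨μs, hμs, hss, a, b, M₁, ha, hb, hM₁, hR⟩ :=
    exists_resolventKernel_uniform hω hl hβ hγ hN hTL hTR
  set Mπ : ℝ≥0∞ := b / (1 - a) with hMπ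
  have hMπtop : Mπ ≠ ⊤ := ENNReal.div_ne_top hb (tsub_pos_of_lt ha).ne'
  refine ⟨μs, hμs, hss, M₁ * N * Mπ.toReal, by positivity, fun ε hε hεN => ?_⟩
  have hr : 0 < (N : ℝ) * ε := by positivity
  obtain ⟨R, hRM, hres, hfel, hly, hdist⟩ := hR ((N : ℝ) * ε) hr hεN
  obtain ⟨π, hπ, hflip, hπV⟩ := exists_isFlipSteadyState_bind_of_resolventKernel hω hl.le hβ.le
    hN0 T_L T_R ε R hres hfel hθ ha hb hly
  refine ⟨π.bind R, hflip, fun g hg hgb => ?_⟩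
  set V : PhaseSpace N → ℝ≥0∞ := fun y => ENNReal.ofReal (Real.exp (θ * P.hamiltonian N y)) with hV
  have hexp_cont : Continuous fun y => Real.exp (θ * P.hamiltonian N y) :=
    Real.continuous_exp.comp (continuous_const.mul (pinnedChain_continuous_hamiltonian ω₂ lam β γ N))
  have hVm : Measurable V := ENNReal.measurable_ofReal.comp hexp_cont.measurable
  -- exponential moments of `π` and of `π R`
  have hπexp : Integrable (fun y => Real.exp (θ * P.hamiltonian N y)) π := by
    refine ⟨hexp_cont.aestronglyMeasurable, ?_⟩
    show ∫⁻ y, ‖Real.exp (θ * P.hamiltonian N y)‖ₑ ∂π < ⊤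
    simp only [Real.enorm_eq_ofReal (Real.exp_nonneg _)]
    exact hπV.trans_lt hMπtop.lt_top
  have hπexp_le : ∫ y, Real.exp (θ * P.hamiltonian N y) ∂π ≤ Mπ.toReal := by
    rw [integral_eq_lintegral_of_nonneg_ae (Eventually.of_forall fun y => (Real.exp_pos _).le)
      hexp_cont.aestronglyMeasurable]
    exact ENNReal.toReal_mono hMπtop hπV
  have hμV : ∫⁻ y, V y ∂(π.bind R) < ⊤ := by
    have h := Literature.Probability.Process.MarkovChain.lintegral_bind_le_of_lyapunov R hVm hly π
    rw [measure_univ, mul_one] at h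
    exact h.trans_lt (ENNReal.add_lt_top.2
      ⟨ENNReal.mul_lt_top (ha.trans_le le_top) (hπV.trans_lt hMπtop.lt_top), hb.lt_top⟩)
  have hμexp : Integrable (fun y => Real.exp (θ * P.hamiltonian N y)) (π.bind R) := by
    refine ⟨hexp_cont.aestronglyMeasurable, ?_⟩
    show ∫⁻ y, ‖Real.exp (θ * P.hamiltonian N y)‖ₑ ∂(π.bind R) < ⊤
    simp only [Real.enorm_eq_ofReal (Real.exp_nonneg _)]
    exact hμV
  have hgi : Integrable g (π.bind R) :=
    hμexp.mono' hg.aestronglyMeasurable (Eventually.of_forall fun y => by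
      rw [Real.norm_eq_abs]; exact hgb y)
  -- iterated integral and the pointwise resolvent estimate (iv)
  rw [integral_bind_of_integrable R π hgi]
  have h2 : ∀ z, |∫ y, g y ∂(R z) - ∫ y, g y ∂μs| ≤
      M₁ * ((N : ℝ) * ε) * Real.exp (θ * P.hamiltonian N z) := fun z => hdist g hg hgb z
  have hsm : StronglyMeasurable fun z => ∫ y, g y ∂(R z) :=
    hg.stronglyMeasurable.integral_kernel (κ := R)
  have hbdi : Integrable (fun z => M₁ * ((N : ℝ) * ε) * Real.exp (θ * P.hamiltonian N z)) π :=
    hπexp.const_mul _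
  have hRi : Integrable (fun z => ∫ y, g y ∂(R z)) π := by
    refine ((hbdi.add (integrable_const |∫ y, g y ∂μs|))).mono' hsm.aestronglyMeasurable
      (Eventually.of_forall fun z => ?_)
    show ‖∫ y, g y ∂(R z)‖ ≤ M₁ * ((N : ℝ) * ε) * Real.exp (θ * P.hamiltonian N z) + |∫ y, g y ∂μs|
    rw [Real.norm_eq_abs]
    have h := h2 z
    have := abs_sub_abs_le_abs_sub (∫ y, g y ∂(R z)) (∫ y, g y ∂μs)
    linarith
  have h3 : ∫ z, ∫ y, g y ∂(R z) ∂π - ∫ y, g y ∂μs = ∫ z, (∫ y, g y ∂(R z) - ∫ y, g y ∂μs) ∂π := by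
    rw [integral_sub hRi (integrable_const _), integral_const, probReal_univ, one_smul]
  rw [h3, ← Real.norm_eq_abs]
  refine (norm_integral_le_of_norm_le hbdi (Eventually.of_forall fun z => by
    rw [Real.norm_eq_abs]; exact h2 z)).trans ?_
  rw [integral_const_mul]
  calc M₁ * ((N : ℝ) * ε) * ∫ z, Real.exp (θ * P.hamiltonian N z) ∂π
      ≤ M₁ * ((N : ℝ) * ε) * Mπ.toReal :=
        mul_le_mul_of_nonneg_left hπexp_le (by positivity)
    _ = M₁ * N * Mπ.toReal * ε := by ring

/-- **Continuity of the steady current in the flip rate at `ε = 0⁺` (fixed length, fixed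
temperatures).** For `pinnedChain ω₂ lam β γ` (all parameters `> 0`), any `N`, `T_L, T_R > 0`, and
the unique weak steady state `μ0` at `(T_L, T_R)`: for every `κ > 0` there is `ε₃ > 0` such that for
all `ε ∈ (0, ε₃]`, the unique weak flip steady state `μ` of `L + εS` at `(T_L, T_R)` satisfies
`|totalCurrent μ - totalCurrent μ0| ≤ κ`. For `N ≤ 1` both currents vanish; for `N ≥ 2`,
`μ0 = μ⋆` and `μ =` the flip steady state of `exists_flipSteadyState_near` by the two uniqueness
hypotheses, and the bond currents are dominated, `|j_i| ≤ K e^{θH}`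
(`pinnedChain_abs_bondCurrent_le`, `one_add_sq_le_exp`). -/
theorem flipSteadyState_totalCurrent_near (hω : 0 < ω₂) (hl : 0 < lam) (hβ : 0 < β) (hγ : 0 < γ)
    (N : ℕ) (hTL : 0 < T_L) (hTR : 0 < T_R) (μ0 : Measure (PhaseSpace N))
    (hμ0 : (pinnedChain ω₂ lam β γ).IsSteadyState N T_L T_R μ0 ∧
      ∀ ν : Measure (PhaseSpace N), (pinnedChain ω₂ lam β γ).IsSteadyState N T_L T_R ν → ν = μ0) :
    ∀ κ : ℝ, 0 < κ → ∃ ε₃ : ℝ, 0 < ε₃ ∧ ∀ ε : ℝ, 0 < ε → ε ≤ ε₃ →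
      ∀ μ : Measure (PhaseSpace N),
        ((pinnedChain ω₂ lam β γ).IsFlipSteadyState N T_L T_R ε μ ∧
          ∀ ν : Measure (PhaseSpace N),
            (pinnedChain ω₂ lam β γ).IsFlipSteadyState N T_L T_R ε ν → ν = μ) →
        |(pinnedChain ω₂ lam β γ).totalCurrent μ - (pinnedChain ω₂ lam β γ).totalCurrent μ0| ≤ κ := by
  intro κ hκ
  set P := pinnedChain ω₂ lam β γ with hPdef
  rcases Nat.lt_or_ge N 2 with hN2 | hN2
  · -- no bond: both currents vanish
    refine ⟨1, one_pos, fun ε _ _ μ _ => ?_⟩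
    rw [totalCurrent_eq_zero_of_le_one P (by omega) μ, totalCurrent_eq_zero_of_le_one P (by omega) μ0,
      sub_zero, abs_zero]
    exact hκ.le
  have hN : 1 < N := hN2
  have hN0 : 0 < N := by omega
  set θ : ℝ := 1 / max T_L T_R / 2 with hθdef
  have hmax : 0 < max T_L T_R := lt_max_of_lt_left hTL
  have hθ : 0 < θ := by positivity
  obtain ⟨μs, hμs, hss, M, hM, hnear⟩ := exists_flipSteadyState_near hω hl hβ hγ hN hTL hTR
  -- `μ⋆ = μ0` by weak uniqueness
  have hμs0 : μs = μ0 := hμ0.2 μs hss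
  -- domination of the bond currents: `|j_i| ≤ Kj e^{θH}`
  set Kj : ℝ := N * ((3 + β) / 2) * (2 * Real.exp θ / θ ^ 2) with hKj
  have hKj0 : 0 < Kj := by positivity
  have hdom : ∀ (i : Fin N) (x : PhaseSpace N), |P.bondCurrent N i x / Kj| ≤
      Real.exp (θ * P.hamiltonian N x) := by
    intro i x
    have hH0 := pinnedChain_hamiltonian_nonneg hω.le hl.le hβ.le γ N x
    have hj := pinnedChain_abs_bondCurrent_le hω.le hl.le hβ.le γ N i x
    have hsq := one_add_sq_le_exp hH0 hθ
    rw [abs_div, abs_of_pos hKj0, div_le_iff₀ hKj0]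
    calc |P.bondCurrent N i x| ≤ N * ((3 + β) / 2 * (1 + P.hamiltonian N x) ^ 2) := hj
      _ = N * ((3 + β) / 2) * (1 + P.hamiltonian N x) ^ 2 := by ring
      _ ≤ N * ((3 + β) / 2) * (2 * Real.exp θ / θ ^ 2 * Real.exp (θ * P.hamiltonian N x)) :=
          mul_le_mul_of_nonneg_left hsq (by positivity)
      _ = Real.exp (θ * P.hamiltonian N x) * Kj := by rw [hKj]; ring
  -- the rate threshold
  refine ⟨min (1 / N) (κ / (N * Kj * M + 1)), lt_min (by positivity) (by positivity),
    fun ε hε hεle μ hμ => ?_⟩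
  have hεN : (N : ℝ) * ε ≤ 1 := by
    have h := hεle.trans (min_le_left _ _)
    have hNpos : (0 : ℝ) < N := by exact_mod_cast hN0
    calc (N : ℝ) * ε ≤ N * (1 / N) := mul_le_mul_of_nonneg_left h hNpos.le
      _ = 1 := by field_simp
  obtain ⟨μ', hμ', hg⟩ := hnear ε hε hεN
  -- `μ = μ'` by weak flip uniqueness
  have hμμ' : μ' = μ := hμ.2 μ' hμ'
  -- per-bond estimate
  have hbond : ∀ i : Fin N, |∫ x, P.bondCurrent N i x ∂μ - ∫ x, P.bondCurrent N i x ∂μ0| ≤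
      Kj * (M * ε) := by
    intro i
    have h := hg (fun x => P.bondCurrent N i x / Kj)
      ((pinnedChain_continuous_bondCurrent ω₂ lam β γ N i).div_const Kj) (hdom i)
    rw [hμμ', hμs0] at h
    simp only [integral_div] at h
    rw [← sub_div, abs_div, abs_of_pos hKj0, div_le_iff₀ hKj0] at h
    linarith
  -- sum over the bonds
  have hsum : |P.totalCurrent μ - P.totalCurrent μ0| ≤ N * (Kj * (M * ε)) := by
    unfold OscillatorChain.totalCurrent
    rw [← Finset.sum_sub_distrib]
    refine (Finset.abs_sum_le_sum_abs _ _).trans ?_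
    calc ∑ i : Fin N, |∫ x, P.bondCurrent N i x ∂μ - ∫ x, P.bondCurrent N i x ∂μ0|
        ≤ ∑ _i : Fin N, Kj * (M * ε) := Finset.sum_le_sum fun i _ => hbond i
      _ = N * (Kj * (M * ε)) := by simp
  refine hsum.trans ?_
  have h2 := hεle.trans (min_le_right _ _)
  have hden : 0 < N * Kj * M + 1 := by positivity
  rw [le_div_iff₀ hden] at h2
  nlinarith [mul_nonneg (mul_nonneg (Nat.cast_nonneg N) hKj0.le) hM, hε.le]

end Pinned


/-- Registered helper sub-goal `helper_flipSteadyStateTotalCurrentNear` of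
stmt-AtomisticToContinuum-11976 (= `flipSteadyState_totalCurrent_near`, fully quantified,
notation-free one-line form): continuity at `ε = 0⁺` of the steady current of the unique weak flip
steady state, at fixed length and fixed bath temperatures. -/
theorem helper_flipSteadyStateTotalCurrentNear : ∀ (ω₂ lam β γ : ℝ), 0 < ω₂ → 0 < lam → 0 < β → 0 < γ → ∀ (N : ℕ) (T_L T_R : ℝ), 0 < T_L → 0 < T_R → ∀ μ0 : MeasureTheory.Measure (Literature.MathematicalPhysics.KineticTheory.HeatConduction.PhaseSpace N), ((Literature.MathematicalPhysics.KineticTheory.HeatConduction.pinnedChain ω₂ lam β γ).IsSteadyState N T_L T_R μ0 ∧ ∀ ν : MeasureTheory.Measure (Literature.MathematicalPhysics.KineticTheory.HeatConduction.PhaseSpace N), (Literature.MathematicalPhysics.KineticTheory.HeatConduction.pinnedChain ω₂ lam β γ).IsSteadyState N T_L T_R ν → ν = μ0) → ∀ κ : ℝ, 0 < κ → ∃ ε₃ : ℝ, 0 < ε₃ ∧ ∀ ε : ℝ, 0 < ε → ε ≤ ε₃ → ∀ μ : MeasureTheory.Measure (Literature.MathematicalPhysics.KineticTheory.HeatConduction.PhaseSpace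 N), ((Literature.MathematicalPhysics.KineticTheory.HeatConduction.pinnedChain ω₂ lam β γ).IsFlipSteadyState N T_L T_R ε μ ∧ ∀ ν : MeasureTheory.Measure (Literature.MathematicalPhysics.KineticTheory.HeatConduction.PhaseSpace N), (Literature.MathematicalPhysics.KineticTheory.HeatConduction.pinnedChain ω₂ lam β γ).IsFlipSteadyState N T_L T_R ε ν → ν = μ) → |(Literature.MathematicalPhysics.KineticTheory.HeatConduction.pinnedChain ω₂ lam β γ).totalCurrent μ - (Literature.MathematicalPhysics.KineticTheory.HeatConduction.pinnedChain ω₂ lam β γ).totalCurrent μ0| ≤ κ :=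
  fun _ _ _ _ hω hl hβ hγ N _ _ hTL hTR μ0 hμ0 =>
    flipSteadyState_totalCurrent_near hω hl hβ hγ N hTL hTR μ0 hμ0

/-! ## §3 Input (P) of `of_equidifferentiable_of_pointwise` holds; the stub from (E) alone -/

section Stub

variable {ω₂ lam β γ : ℝ}

/-- **Input (P) of `of_equidifferentiable_of_pointwise`, proved.** For the unique deterministic
steady family `μ0` and `T > 0`: for every `δ` with `0 < |δ| < 2T` (so eventually along
`δ → 0, δ ≠ 0`), every `κ > 0`, all small `ε > 0` and every unique flip-steady family `με` at rate
`ε`: `|J(με, δ) - J(μ0, δ)| ≤ κ`, `J(μ, δ) = totalCurrent (μ (T+δ/2) (T-δ/2))`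
(`flipSteadyState_totalCurrent_near` at the temperatures `T ± δ/2 > 0`). -/
theorem flip_pointwise_continuity (hω : 0 < ω₂) (hl : 0 < lam) (hβ : 0 < β) (hγ : 0 < γ)
    {T : ℝ} (hT : 0 < T) {N : ℕ} (μ0 : ℝ → ℝ → Measure (PhaseSpace N))
    (hμ0 : ∀ T_L T_R : ℝ, 0 < T_L → 0 < T_R →
      (pinnedChain ω₂ lam β γ).IsSteadyState N T_L T_R (μ0 T_L T_R) ∧
        ∀ ν : Measure (PhaseSpace N),
          (pinnedChain ω₂ lam β γ).IsSteadyState N T_L T_R ν → ν = μ0 T_L T_R) :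
    ∀ᶠ δ in 𝓝[≠] (0 : ℝ), ∀ κ : ℝ, 0 < κ → ∃ ε₃ : ℝ, 0 < ε₃ ∧ ∀ ε : ℝ, 0 < ε → ε ≤ ε₃ →
      ∀ με : ℝ → ℝ → Measure (PhaseSpace N),
        (∀ T_L T_R : ℝ, 0 < T_L → 0 < T_R →
          (pinnedChain ω₂ lam β γ).IsFlipSteadyState N T_L T_R ε (με T_L T_R) ∧
            ∀ ν : Measure (PhaseSpace N),
              (pinnedChain ω₂ lam β γ).IsFlipSteadyState N T_L T_R ε ν → ν = με T_L T_R) →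
        |(pinnedChain ω₂ lam β γ).totalCurrent (με (T + δ / 2) (T - δ / 2)) -
            (pinnedChain ω₂ lam β γ).totalCurrent (μ0 (T + δ / 2) (T - δ / 2))| ≤ κ := by
  -- for `|δ| < 2T` both temperatures are positive
  have hball : ∀ᶠ δ in 𝓝[≠] (0 : ℝ), |δ| < 2 * T := by
    have : Metric.ball (0 : ℝ) (2 * T) ∈ 𝓝 (0 : ℝ) := Metric.ball_mem_nhds 0 (by positivity)
    filter_upwards [mem_nhdsWithin_of_mem_nhds this] with δ hδ
    simpa [Real.dist_eq] using hδ
  filter_upwards [hball] with δ hδ κ hκ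
  have h1 : 0 < T + δ / 2 := by
    have := neg_abs_le δ
    linarith
  have h2 : 0 < T - δ / 2 := by
    have := le_abs_self δ
    linarith
  obtain ⟨ε₃, hε₃, h⟩ := flipSteadyState_totalCurrent_near hω hl hβ hγ N h1 h2
    (μ0 (T + δ / 2) (T - δ / 2)) (hμ0 _ _ h1 h2) κ hκ
  exact ⟨ε₃, hε₃, fun ε hε hεle με hμε => h ε hε hεle _ (hμε _ _ h1 h2)⟩

/-- **The stub from equi-differentiability alone.** `stub_fixedLengthNoiseContinuity` at fixed
parameters, temperature `T > 0` and length `N`, for the unique deterministic family `μ0` with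
response `D0`, follows from the single analytic input (E): the response quotients `J(με, δ)/δ` of
the unique flip-steady families converge to their limits with a modulus `ω(δ) → 0` common to all
small `ε > 0` on a common punctured neighbourhood of `δ = 0` — input (P) being
`flip_pointwise_continuity`. (E) is the `ε`-uniform first-order (in the temperature difference)
regularity of the flip-noisy steady state, the Hairer–Majda-type linear-response input that is not
in the tree. -/
theorem of_equidifferentiable (hω : 0 < ω₂) (hl : 0 < lam) (hβ : 0 < β) (hγ : 0 < γ)
    {T : ℝ} (hT : 0 < T) {N : ℕ} (μ0 : ℝ → ℝ → Measure (PhaseSpace N))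
    (hμ0 : ∀ T_L T_R : ℝ, 0 < T_L → 0 < T_R →
      (pinnedChain ω₂ lam β γ).IsSteadyState N T_L T_R (μ0 T_L T_R) ∧
        ∀ ν : Measure (PhaseSpace N),
          (pinnedChain ω₂ lam β γ).IsSteadyState N T_L T_R ν → ν = μ0 T_L T_R)
    {D0 : ℝ}
    (hD0 : Tendsto (fun δ : ℝ =>
      (pinnedChain ω₂ lam β γ).totalCurrent (μ0 (T + δ / 2) (T - δ / 2)) / δ) (𝓝[≠] 0) (𝓝 D0))
    (hE : ∃ w : ℝ → ℝ, Tendsto w (𝓝[≠] 0) (𝓝 0) ∧ ∃ ε₁ : ℝ, 0 < ε₁ ∧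
      ∀ᶠ δ in 𝓝[≠] (0 : ℝ), ∀ ε : ℝ, 0 < ε → ε ≤ ε₁ →
        ∀ με : ℝ → ℝ → Measure (PhaseSpace N),
          (∀ T_L T_R : ℝ, 0 < T_L → 0 < T_R →
            (pinnedChain ω₂ lam β γ).IsFlipSteadyState N T_L T_R ε (με T_L T_R) ∧
              ∀ ν : Measure (PhaseSpace N),
                (pinnedChain ω₂ lam β γ).IsFlipSteadyState N T_L T_R ε ν → ν = με T_L T_R) →
          ∀ Dε : ℝ,
            Tendsto (fun δ' : ℝ =>
              (pinnedChain ω₂ lam β γ).totalCurrent (με (T + δ' / 2) (T - δ' / 2)) / δ')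
              (𝓝[≠] 0) (𝓝 Dε) →
            |(pinnedChain ω₂ lam β γ).totalCurrent (με (T + δ / 2) (T - δ / 2)) / δ - Dε| ≤ w δ) :
    ∀ η : ℝ, 0 < η → ∃ ε₂ : ℝ, 0 < ε₂ ∧ ∀ ε : ℝ, 0 < ε → ε ≤ ε₂ →
      ∀ με : ℝ → ℝ → Measure (PhaseSpace N),
        (∀ T_L T_R : ℝ, 0 < T_L → 0 < T_R →
          (pinnedChain ω₂ lam β γ).IsFlipSteadyState N T_L T_R ε (με T_L T_R) ∧
            ∀ ν : Measure (PhaseSpace N),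
              (pinnedChain ω₂ lam β γ).IsFlipSteadyState N T_L T_R ε ν → ν = με T_L T_R) →
        ∀ Dε : ℝ,
          Tendsto (fun δ : ℝ =>
            (pinnedChain ω₂ lam β γ).totalCurrent (με (T + δ / 2) (T - δ / 2)) / δ)
            (𝓝[≠] 0) (𝓝 Dε) →
          |Dε - D0| ≤ η :=
  of_equidifferentiable_of_pointwise μ0 hD0 (flip_pointwise_continuity hω hl hβ hγ hT μ0 hμ0) hE

end Stub

end Summit.AtomisticToContinuum.FouriersLaw.Theorems.FixedLengthNoiseContinuity

end
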